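import Mathlib
import Summits.KontsevichZagierPeriods.KontsevichZagierPeriods.Theorems.GenusOneIteratedKummerFamilyMoves

/-!
# `KummerFamily` (item stmt-KontsevichZagierPeriods-6780, route GenusOneIterated) — the cells and
the reflection move on `ℝ²`

Two-variable geometry of the move certificate for
`∫∫_{e₃<x₀<x₁<e₂} (x₁ − x₀)/(√f(x₀)√f(x₁)) ~ ∫_{e₁−e₂}^{e₁−e₃} du/(2u)` (see
`GenusOneIteratedKummerFamilyMoves.lean` for the one-variable ingredients `σ`, `φ`):

* the open triangle `T = {e₃ < x₀ < x₁ < e₂}` is cut along the fixed curve `x₁ = σ(x₀)` of the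
  involution `Φ(x₀, x₁) = (σ x₁, σ x₀)` into `T₁ = {x₁ ≤ σ x₀}` and `T₂ = {σ x₀ ≤ x₁}`
  (`ℚ`-semialgebraic, meeting in a null curve), and `Φ` maps `T₁` bijectively onto `T₂`
  (`image_Phi`, `injOn_Phi`) with derivative `(σ′(x₁) pr₁, σ′(x₀) pr₀)` (`hasFDerivAt_Phi`);
* the antisymmetric integrand `B(x) = −φ′(x₁)/√f(x₀) = −(σ x₁ − x₁)/(√f(x₁)√f(x₀))` is
  `ℚ`-semialgebraic and absolutely integrable on `T` (domination by
  `(e₂ − e₃)/(√f(x₀)√f(x₁))`, a product of two integrable inverse square roots, `integrableOn_B`);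
* the closed Newton–Leibniz band `{e₃ < x₀ < e₂, x₀ ≤ x₁ ≤ e₂}` contains `T` and exceeds it by
  a null set (`volume_band_diff_eq_zero`).

References: Kontsevich–Zagier, *Periods* (2001), §1.2 rules (1)–(3).
-/

noncomputable section

open Set MeasureTheory
open Literature.NumberTheory.Transcendental Literature.ModelTheory.ExponentialFields

namespace Summit.KontsevichZagierPeriods.GenusOneIterated.KummerFamily

variable (E : KZ.EllCurve)

/-! ### The reflection move `Φ(x₀, x₁) = (σ x₁, σ x₀)` on the two half-triangles -/

/-- `Φ` maps `T₁ = {e₃ < x₀ < x₁ < e₂, x₁ ≤ σ x₀}` onto `T₂ = {e₃ < x₀ < x₁ < e₂, σ x₀ ≤ x₁}`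
(`σ` is a decreasing involution of `(e₃, e₂)`). [folklore] -/
theorem image_Phi :
    (fun x : Fin 2 → ℝ =>
        (![E.e₁ + (E.e₁ - E.e₂) * (E.e₁ - E.e₃) / (x 1 - E.e₁),
            E.e₁ + (E.e₁ - E.e₂) * (E.e₁ - E.e₃) / (x 0 - E.e₁)] : Fin 2 → ℝ)) ''
        {x | (E.e₃ < x 0 ∧ x 0 < x 1 ∧ x 1 < E.e₂) ∧
          x 1 ≤ E.e₁ + (E.e₁ - E.e₂) * (E.e₁ - E.e₃) / (x 0 - E.e₁)} =
      {x | (E.e₃ < x 0 ∧ x 0 < x 1 ∧ x 1 < E.e₂) ∧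
          E.e₁ + (E.e₁ - E.e₂) * (E.e₁ - E.e₃) / (x 0 - E.e₁) ≤ x 1} := by
  have h21 := E.e₂_lt_e₁
  ext u
  simp only [mem_image, mem_setOf_eq]
  constructor
  · rintro ⟨x, ⟨⟨h0, h01, h1⟩, hle⟩, rfl⟩
    simp only [Matrix.cons_val_zero, Matrix.cons_val_one]
    have hx0 : x 0 < E.e₂ := h01.trans h1
    have hx1 : E.e₃ < x 1 := h0.trans h01
    refine ⟨⟨(sigma_mem E hx1 h1).1,
      sigma_lt_sigma E (hx0.trans h21) (h1.trans h21) h01, (sigma_mem E h0 hx0).2⟩, ?_⟩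
    rw [sigma_sigma E (h1.trans h21).ne]
    exact hle
  · rintro ⟨⟨h0, h01, h1⟩, hle⟩
    have hu0 : u 0 < E.e₂ := h01.trans h1
    have hu1 : E.e₃ < u 1 := h0.trans h01
    refine ⟨![E.e₁ + (E.e₁ - E.e₂) * (E.e₁ - E.e₃) / (u 1 - E.e₁),
        E.e₁ + (E.e₁ - E.e₂) * (E.e₁ - E.e₃) / (u 0 - E.e₁)], ⟨⟨(sigma_mem E hu1 h1).1,
      sigma_lt_sigma E (hu0.trans h21) (h1.trans h21) h01, (sigma_mem E h0 hu0).2⟩, ?_⟩, ?_⟩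
    · simp only [Matrix.cons_val_zero, Matrix.cons_val_one]
      rw [sigma_sigma E (h1.trans h21).ne]
      exact hle
    · funext i
      fin_cases i
      · simp [sigma_sigma' E]
      · simp [sigma_sigma' E]

/-- `Φ` is injective off the pole lines `x₀ = e₁`, `x₁ = e₁` (`σ` is an involution). [folklore] -/
theorem injOn_Phi {s : Set (Fin 2 → ℝ)} (hs : ∀ x ∈ s, x 0 ≠ E.e₁ ∧ x 1 ≠ E.e₁) :
    InjOn (fun x : Fin 2 → ℝ =>
      (![E.e₁ + (E.e₁ - E.e₂) * (E.e₁ - E.e₃) / (x 1 - E.e₁),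
          E.e₁ + (E.e₁ - E.e₂) * (E.e₁ - E.e₃) / (x 0 - E.e₁)] : Fin 2 → ℝ)) s := by
  intro x hx y hy h
  have h0 := congr_fun h 0
  have h1 := congr_fun h 1
  simp only [Matrix.cons_val_zero, Matrix.cons_val_one] at h0 h1
  have hx0 := sigma_sigma E (hs x hx).1
  have hx1 := sigma_sigma E (hs x hx).2
  rw [h1, sigma_sigma E (hs y hy).1] at hx0
  rw [h0, sigma_sigma E (hs y hy).2] at hx1
  funext i
  fin_cases i
  · exact hx0.symm
  · exact hx1.symm

/-- The derivative of `Φ` off the pole lines: `DΦ = (σ′(x₁) pr₁, σ′(x₀) pr₀)`. [folklore] -/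
theorem hasFDerivAt_Phi {x : Fin 2 → ℝ} (h0 : x 0 ≠ E.e₁) (h1 : x 1 ≠ E.e₁) :
    HasFDerivAt (fun x : Fin 2 → ℝ =>
        (![E.e₁ + (E.e₁ - E.e₂) * (E.e₁ - E.e₃) / (x 1 - E.e₁),
            E.e₁ + (E.e₁ - E.e₂) * (E.e₁ - E.e₃) / (x 0 - E.e₁)] : Fin 2 → ℝ))
      (ContinuousLinearMap.pi
        ![(-((E.e₁ - E.e₂) * (E.e₁ - E.e₃)) / (x 1 - E.e₁) ^ 2) •
            ContinuousLinearMap.proj (R := ℝ) (φ := fun _ : Fin 2 => ℝ) 1,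
          (-((E.e₁ - E.e₂) * (E.e₁ - E.e₃)) / (x 0 - E.e₁) ^ 2) •
            ContinuousLinearMap.proj (R := ℝ) (φ := fun _ : Fin 2 => ℝ) 0]) x := by
  refine hasFDerivAt_pi'.2 (Fin.forall_fin_two.2 ⟨?_, ?_⟩)
  · simp only [Matrix.cons_val_zero, ContinuousLinearMap.proj_pi]
    have hc := (hasDerivAt_sigma E h1).comp_hasFDerivAt x (hasFDerivAt_apply (𝕜 := ℝ) 1 x)
    exact hc
  · simp only [Matrix.cons_val_one, ContinuousLinearMap.proj_pi]
    have hc := (hasDerivAt_sigma E h0).comp_hasFDerivAt x (hasFDerivAt_apply (𝕜 := ℝ) 0 x)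
    exact hc

/-- `Φ` is a `ℚ`-semialgebraic map on every `ℚ`-semialgebraic set off the pole lines. [folklore] -/
theorem isSemialgebraicMapOn_Phi {s : Set (Fin 2 → ℝ)} (hs : IsSemialgebraic ℚ s)
    (h : ∀ x ∈ s, x 0 ≠ E.e₁ ∧ x 1 ≠ E.e₁) :
    IsSemialgebraicMapOn ℚ s (fun x : Fin 2 → ℝ =>
      (![E.e₁ + (E.e₁ - E.e₂) * (E.e₁ - E.e₃) / (x 1 - E.e₁),
          E.e₁ + (E.e₁ - E.e₂) * (E.e₁ - E.e₃) / (x 0 - E.e₁)] : Fin 2 → ℝ)) := by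
  refine IsSemialgebraicMapOn.of_forall hs (Fin.forall_fin_two.2 ⟨?_, ?_⟩)
  · exact (isSemialgebraicFunOn_sigma_apply E hs 1 fun x hx => (h x hx).2).congr
      fun x _ => by simp
  · exact (isSemialgebraicFunOn_sigma_apply E hs 0 fun x hx => (h x hx).1).congr
      fun x _ => by simp

/-! ### The two half-triangles -/

/-- `T₁ = {x ∈ T | x₁ ≤ σ(x₀)}` is `ℚ`-semialgebraic (graph elimination). [folklore] -/
theorem isSemialgebraic_T₁ {T : Set (Fin 2 → ℝ)} (hT : IsSemialgebraic ℚ T)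
    (hT' : ∀ x ∈ T, x 0 ≠ E.e₁) :
    IsSemialgebraic ℚ {x | x ∈ T ∧ x 1 ≤ E.e₁ + (E.e₁ - E.e₂) * (E.e₁ - E.e₃) / (x 0 - E.e₁)} := by
  have h := (IsSemialgebraicFunOn.sub_holds (isSemialgebraicFunOn_sigma_apply E hT 0 hT')
    (isSemialgebraicFunOn_coord hT 1)).isSemialgebraic_sep_nonneg
  convert h using 1
  ext x
  simp only [mem_setOf_eq, Pi.sub_apply, sub_nonneg]

/-- `T₂ = {x ∈ T | σ(x₀) ≤ x₁}` is `ℚ`-semialgebraic. [folklore] -/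
theorem isSemialgebraic_T₂ {T : Set (Fin 2 → ℝ)} (hT : IsSemialgebraic ℚ T)
    (hT' : ∀ x ∈ T, x 0 ≠ E.e₁) :
    IsSemialgebraic ℚ {x | x ∈ T ∧ E.e₁ + (E.e₁ - E.e₂) * (E.e₁ - E.e₃) / (x 0 - E.e₁) ≤ x 1} := by
  have h := (IsSemialgebraicFunOn.sub_holds (isSemialgebraicFunOn_coord hT 1)
    (isSemialgebraicFunOn_sigma_apply E hT 0 hT')).isSemialgebraic_sep_nonneg
  convert h using 1
  ext x
  simp only [mem_setOf_eq, Pi.sub_apply, sub_nonneg]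

/-- The two half-triangles meet in (a subset of) the graph `x₁ = σ(x₀)`, a null set. [folklore] -/
theorem volume_T₁_inter_T₂ {T : Set (Fin 2 → ℝ)} (hT : ∀ x ∈ T, x 0 < E.e₁) :
    volume ({x | x ∈ T ∧ x 1 ≤ E.e₁ + (E.e₁ - E.e₂) * (E.e₁ - E.e₃) / (x 0 - E.e₁)} ∩
      {x | x ∈ T ∧ E.e₁ + (E.e₁ - E.e₂) * (E.e₁ - E.e₃) / (x 0 - E.e₁) ≤ x 1}) = 0 := by
  have hS : IsSemialgebraic ℚ {p : Fin 1 → ℝ | p 0 < E.e₁} :=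
    KZ.isSemialgebraic_setOf_apply_lt_const E.isAlgebraic_e₁ 0
  have hg := KZ.volume_graph_eq_zero
    (isSemialgebraicFunOn_sigma_apply E hS 0 fun p hp => ne_of_lt hp)
  refine measure_mono_null (fun x hx => ?_) hg
  obtain ⟨⟨hxT, h1⟩, ⟨-, h2⟩⟩ := hx
  refine ⟨?_, ?_⟩
  · show Fin.init x 0 < E.e₁
    exact hT x hxT
  · show x (Fin.last 1) = E.e₁ + (E.e₁ - E.e₂) * (E.e₁ - E.e₃) / (Fin.init x 0 - E.e₁)
    exact le_antisymm h1 h2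

/-! ### The antisymmetric integrand `B(x) = −(σ x₁ − x₁)/(√f(x₁) √f(x₀))` -/

/-- `B` is `ℚ`-semialgebraic on every `ℚ`-semialgebraic set off the pole line `x₁ = e₁`.
[folklore] -/
theorem isSemialgebraicFunOn_B {s : Set (Fin 2 → ℝ)} (hs : IsSemialgebraic ℚ s)
    (h : ∀ x ∈ s, x 1 ≠ E.e₁) :
    IsSemialgebraicFunOn ℚ s (fun x : Fin 2 → ℝ =>
      -((E.e₁ + (E.e₁ - E.e₂) * (E.e₁ - E.e₃) / (x 1 - E.e₁) - x 1) / √(E.f (x 1))) *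
        (1 / √(E.f (x 0)))) := by
  have hσ := IsSemialgebraicFunOn.sub_holds (isSemialgebraicFunOn_sigma_apply E hs 1 h)
    (isSemialgebraicFunOn_coord hs 1)
  have hq : IsSemialgebraicFunOn ℚ s (fun x : Fin 2 → ℝ =>
      (E.e₁ + (E.e₁ - E.e₂) * (E.e₁ - E.e₃) / (x 1 - E.e₁) - x 1) / √(E.f (x 1))) :=
    (IsSemialgebraicFunOn.mul_holds hσ (isSemialgebraicFunOn_inv_sqrt_f_apply E hs 1)).congr
      fun x _ => by simp only [Pi.mul_apply, Pi.sub_apply, mul_one_div]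
  exact (IsSemialgebraicFunOn.mul_holds hq.neg (isSemialgebraicFunOn_inv_sqrt_f_apply E hs 0)).congr
    fun x _ => by simp only [Pi.mul_apply, Pi.neg_apply]

/-- **Absolute integrability of `B` on the triangle**: on `T ⊆ (e₃, e₂)²`,
`|B| ≤ (e₂ − e₃)/(√f(x₀)√f(x₁))`, a product of two integrable inverse square roots
(`KZ.EllCurve.integrableOn_inv_sqrt_f`, Tonelli). [folklore] -/
theorem integrableOn_B {T : Set (Fin 2 → ℝ)} (hTs : IsSemialgebraic ℚ T)
    (hT : T ⊆ {x | E.e₃ < x 0 ∧ x 0 < E.e₂ ∧ E.e₃ < x 1 ∧ x 1 < E.e₂}) :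
    IntegrableOn (fun x : Fin 2 → ℝ =>
      -((E.e₁ + (E.e₁ - E.e₂) * (E.e₁ - E.e₃) / (x 1 - E.e₁) - x 1) / √(E.f (x 1))) *
        (1 / √(E.f (x 0)))) T := by
  have hTm : MeasurableSet T := IsSemialgebraic.measurableSet_holds hTs
  have hB := isSemialgebraicFunOn_B E hTs fun x hx => ((hT hx).2.2.2.trans E.e₂_lt_e₁).ne
  have hG : Integrable (fun x : Fin 2 → ℝ =>
      ∏ k, (Ioo E.e₃ E.e₂).indicator (fun t => (√(E.f t))⁻¹) (x k))
      (volume : Measure (Fin 2 → ℝ)) :=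
    Integrable.fintype_prod (μ := fun _ : Fin 2 => (volume : Measure ℝ))
      (f := fun _ : Fin 2 => (Ioo E.e₃ E.e₂).indicator fun t => (√(E.f t))⁻¹)
      fun _ => (E.integrableOn_inv_sqrt_f).integrable_indicator measurableSet_Ioo
  refine Integrable.mono' ((hG.const_mul (E.e₂ - E.e₃)).integrableOn)
    (KZ.aestronglyMeasurable_of_isSemialgebraicFunOn hB hTm) ?_
  filter_upwards [ae_restrict_mem hTm] with x hx
  obtain ⟨h0, h0', h1, h1'⟩ := hT hx
  rw [Fin.prod_univ_two, indicator_of_mem (show x 0 ∈ Ioo E.e₃ E.e₂ from ⟨h0, h0'⟩),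
    indicator_of_mem (show x 1 ∈ Ioo E.e₃ E.e₂ from ⟨h1, h1'⟩)]
  have hσ := sigma_mem E h1 h1'
  have hs0 : 0 < √(E.f (x 0)) := Real.sqrt_pos.2 (E.f_pos h0 h0')
  have hs1 : 0 < √(E.f (x 1)) := Real.sqrt_pos.2 (E.f_pos h1 h1')
  have habs : |E.e₁ + (E.e₁ - E.e₂) * (E.e₁ - E.e₃) / (x 1 - E.e₁) - x 1| ≤ E.e₂ - E.e₃ :=
    abs_sub_le_iff.2 ⟨by linarith [hσ.2], by linarith [hσ.1]⟩
  rw [Real.norm_eq_abs, abs_mul, abs_neg, abs_div, abs_of_pos hs1, abs_of_pos (one_div_pos.2 hs0)]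
  calc |E.e₁ + (E.e₁ - E.e₂) * (E.e₁ - E.e₃) / (x 1 - E.e₁) - x 1| / √(E.f (x 1)) *
        (1 / √(E.f (x 0)))
      = |E.e₁ + (E.e₁ - E.e₂) * (E.e₁ - E.e₃) / (x 1 - E.e₁) - x 1| *
          ((√(E.f (x 0)))⁻¹ * (√(E.f (x 1)))⁻¹) := by ring
    _ ≤ (E.e₂ - E.e₃) * ((√(E.f (x 0)))⁻¹ * (√(E.f (x 1)))⁻¹) :=
        mul_le_mul_of_nonneg_right habs (by positivity)

/-! ### The Newton–Leibniz band `{e₃ < x₀ < e₂, x₀ ≤ x₁ ≤ e₂}` -/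

/-- Membership in the band, in coordinates. [folklore] -/
theorem mem_band_iff (z : Fin 2 → ℝ) :
    z ∈ {z : Fin 2 → ℝ | Fin.init z ∈ {p : Fin 1 → ℝ | E.e₃ < p 0 ∧ p 0 < E.e₂} ∧
        Fin.init z 0 ≤ z (Fin.last 1) ∧ z (Fin.last 1) ≤ E.e₂} ↔
      E.e₃ < z 0 ∧ z 0 < E.e₂ ∧ z 0 ≤ z 1 ∧ z 1 ≤ E.e₂ := by
  simp only [mem_setOf_eq, Fin.init, Fin.castSucc_zero, and_assoc]
  rfl

/-- The band is `ℚ`-semialgebraic. [folklore] -/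
theorem isSemialgebraic_band :
    IsSemialgebraic ℚ {z : Fin 2 → ℝ | Fin.init z ∈ {p : Fin 1 → ℝ | E.e₃ < p 0 ∧ p 0 < E.e₂} ∧
        Fin.init z 0 ≤ z (Fin.last 1) ∧ z (Fin.last 1) ≤ E.e₂} := by
  have h1 : IsSemialgebraic ℚ {z : Fin 2 → ℝ | E.e₃ < z 0} :=
    KZ.isSemialgebraic_setOf_const_lt_apply E.isAlgebraic_e₃ 0
  have h2 : IsSemialgebraic ℚ {z : Fin 2 → ℝ | z 0 < E.e₂} :=
    KZ.isSemialgebraic_setOf_apply_lt_const E.isAlgebraic_e₂ 0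
  have h3 : IsSemialgebraic ℚ {z : Fin 2 → ℝ | z 0 ≤ z 1} := by
    simpa using isSemialgebraic_setOf_eval_le (k := ℚ) (R := ℝ)
      (MvPolynomial.X (0 : Fin 2)) (MvPolynomial.X 1)
  have h4 : IsSemialgebraic ℚ {z : Fin 2 → ℝ | z 1 ≤ E.e₂} := by
    convert (KZ.isSemialgebraic_setOf_const_lt_apply E.isAlgebraic_e₂ (1 : Fin 2)).compl using 1
    ext z
    simp
  convert (h1.inter h2).inter (h3.inter h4) using 1
  ext z
  rw [mem_band_iff]
  simp only [mem_inter_iff, mem_setOf_eq, and_assoc]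

/-- The band contains the open triangle. [folklore] -/
theorem subset_band {T : Set (Fin 2 → ℝ)} (hT : ∀ x ∈ T, E.e₃ < x 0 ∧ x 0 < x 1 ∧ x 1 < E.e₂) :
    T ⊆ {z : Fin 2 → ℝ | Fin.init z ∈ {p : Fin 1 → ℝ | E.e₃ < p 0 ∧ p 0 < E.e₂} ∧
        Fin.init z 0 ≤ z (Fin.last 1) ∧ z (Fin.last 1) ≤ E.e₂} := by
  intro x hx
  obtain ⟨h0, h01, h1⟩ := hT x hx
  exact (mem_band_iff E x).2 ⟨h0, h01.trans h1, h01.le, h1.le⟩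

/-- The band exceeds the open triangle by a null set (the diagonal `x₁ = x₀` and the edge
`x₁ = e₂`). [folklore] -/
theorem volume_band_diff_eq_zero {T : Set (Fin 2 → ℝ)}
    (hT : ∀ x, x ∈ T ↔ E.e₃ < x 0 ∧ x 0 < x 1 ∧ x 1 < E.e₂) :
    volume ({z : Fin 2 → ℝ | Fin.init z ∈ {p : Fin 1 → ℝ | E.e₃ < p 0 ∧ p 0 < E.e₂} ∧
        Fin.init z 0 ≤ z (Fin.last 1) ∧ z (Fin.last 1) ≤ E.e₂} \ T) = 0 := by
  have hA : volume {z : Fin 2 → ℝ | z (Fin.last 1) = E.e₂} = 0 := KZ.volume_setOf_last_eq_zero E.e₂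
  have hB : volume {z : Fin 2 → ℝ | Fin.init z ∈ (univ : Set (Fin 1 → ℝ)) ∧
      z (Fin.last 1) = (Fin.init z) 0} = 0 :=
    KZ.volume_graph_eq_zero (isSemialgebraicFunOn_coord isSemialgebraic_univ 0)
  refine measure_mono_null (fun z hz => ?_) (measure_union_null hA hB)
  obtain ⟨hz, hzT⟩ := hz
  rw [mem_band_iff] at hz
  obtain ⟨h0, h0', h01, h1⟩ := hz
  rw [hT] at hzT
  simp only [mem_union, mem_setOf_eq, mem_univ, true_and]
  rcases h1.lt_or_eq with h1 | h1
  · right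
    rcases h01.lt_or_eq with h01 | h01
    · exact absurd ⟨h0, h01, h1⟩ hzT
    · exact h01.symm
  · exact Or.inl h1

end Summit.KontsevichZagierPeriods.GenusOneIterated.KummerFamily

end
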